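import Summits.Ventures.PercRepro.C025ProfileRowReduction
import Summits.Ventures.PercRepro.C025ProfileGenHall
import Summits.Ventures.PercRepro.C025ProfileCertBridge
/-!
# THE ROW (2,4) OF THE PROFILE INEQUALITY — the rule-free reduction to simple matroids of rank `≥ 5` (night-3 g9)
NIGHT3-G9-TWO-FOUR-CERTIFICATE.md §0. Independent of any certificate rule: `(Π_{2,4})` holds on EVERY finite matroid as
soon as it holds on every SIMPLE matroid of rank `≥ 5` — rank `≤ 3` is the empty level (`profileIneq_of_eRank_lt`), rank
`4` the top level (`Profile.profileIneq_top`), and a non-simple matroid reduces to its simplification by the row reduction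
`profileIneq_row_of_simple` with the row `(1,3)` (`profileIneq_one_all`). The same for the Hall form `(H⁺_{2,4})`, and the
certificate form: a family `W` that is a local certificate (`(Cap)`, `(Dem)` of `profileIneq_of_cert`) on every simple
matroid of rank `≥ 5` proves the row everywhere. The rule `w24` of `C025ProfileFourRule` is NOT such a certificate
(the paper's erratum of 10:4xZ: a 10-point rank-5 configuration overloads a rank-4 set); these reductions do not depend on it.
-/
open scoped Matroid
namespace PercRepro
open Set Finset ThmH
section FourReduce
variable {α : Type} [DecidableEq α]

/-- `(Π_{2,4})` on a simple matroid, given it in rank `≥ 5` (the lower ranks are the empty and top levels). -/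
theorem profileIneq_two_four_of_simple_of_five (N : Matroid α) [N.Finite]
    (h5 : (5 : ℕ∞) ≤ N.eRank → Profile.ProfileIneq N 2 4) : Profile.ProfileIneq N 2 4 := by
  have hRtop : N.eRank ≠ ⊤ := N.eRank_ne_top_iff.2 inferInstance
  obtain ⟨R, hRe⟩ := ENat.ne_top_iff_exists.1 hRtop
  rcases Nat.lt_or_ge R 4 with hlt4 | hge4
  · apply profileIneq_of_eRank_lt
    rw [← hRe]; exact_mod_cast hlt4
  rcases Nat.lt_or_ge R 5 with hlt5 | hge5
  · have heq4 : R = 4 := by omega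
    exact Profile.profileIneq_top (R := 4) (by rw [← hRe, heq4]) 2
  · exact h5 (by rw [← hRe]; exact_mod_cast hge5)

/-- **THE ROW `(2,4)` FOR EVERY FINITE MATROID REDUCES TO SIMPLE MATROIDS OF RANK `≥ 5`.** -/
theorem profileIneq_two_four_of_simple_five
    (h : ∀ (N : Matroid α) [N.Finite], (∀ T ⊆ N.E, T.encard ≤ 2 → N.Indep T) → (5 : ℕ∞) ≤ N.eRank →
      Profile.ProfileIneq N 2 4)
    (M : Matroid α) [M.Finite] : Profile.ProfileIneq M 2 4 :=
  profileIneq_row_of_simple (q := 1) (u := 3) (by omega)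
    (fun N _ hs => profileIneq_two_four_of_simple_of_five N (h N hs))
    (fun N _ => profileIneq_one_all N 3 (by omega)) M

/-- The certificate form: a family `W` (depending on the matroid) that is a local certificate — `(Cap)`: every rank-`4`
set receives at most `1`; `(Dem)`: every rank-`2` set `B` receives at least its price — on every simple matroid of rank
`≥ 5` proves the row `(2,4)` on every finite matroid. -/
theorem profileIneq_two_four_of_cert_on_simple
    (W : Matroid α → Finset α → Finset α → ℚ)
    (hCap : ∀ (N : Matroid α) [N.Finite], (∀ T ⊆ N.E, T.encard ≤ 2 → N.Indep T) → (5 : ℕ∞) ≤ N.eRank →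
      ∀ S ∈ Shadow.levelSet N 4, ∑ B ∈ (Profile.Rq N 2).filter (· ⊆ S), W N B S ≤ 1)
    (hDem : ∀ (N : Matroid α) [N.Finite], (∀ T ⊆ N.E, T.encard ≤ 2 → N.Indep T) → (5 : ℕ∞) ≤ N.eRank →
      ∀ B ∈ Profile.Rq N 2, Profile.price N 2 4 B ≤ ∑ S ∈ (Shadow.levelSet N 4).filter (B ⊆ ·), W N B S)
    (M : Matroid α) [M.Finite] : Profile.ProfileIneq M 2 4 :=
  profileIneq_two_four_of_simple_five
    (fun N _ hs hR => profileIneq_of_cert (M := N) 2 4 (W N) (hCap N hs hR) (hDem N hs hR)) M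

end FourReduce
end PercRepro
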